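import Literature.MathematicalPhysics.QuantumFieldTheory.Balaban1983to89.B11Eq98CurrentSlot
import Literature.MathematicalPhysics.QuantumFieldTheory.Balaban1983to89.B11Prop6Model

/-!
# `Balaban1983to89.B11Prop4ModelW80` — T. Bałaban, *The variational problem and background fields in renormalization group method for
lattice gauge theories*, Commun. Math. Phys. **102** (1985) 277–309 [Balaban1985Variational], **Propositions 4 and 6** (pp. 292–296): the
TYPED STATEMENTS OF RECORD `B11.Prop4Printed` / `B11.Prop6Printed` INHABITED AT THE CONCRETE FUNCTIONAL DERIVATIVE `W80 = (δ/δA′)V` of the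
pub-balaban NE9 files (model instance, ONE lattice, ONE background; the letters of `B11Eq98CurrentSlot.prop4Hyp_W80` displayed as hypotheses)

statement-level skeleton of published theorems with citation tags; proofs where landed; nothing here is a claim about the Yang–Mills mass gap

PDF held: `paper:balaban1985-cmp102-variational-background` (journal page = PDF page + 276); pp. 292–296 [PDF 16–20].

CITATION HEADER / WHAT IS REPRODUCED.  Mega-formalization `lit-balaban`, HOME `run/shared/lean/pub/lit-balaban/`, reader/typer/fold-owner seat
r08 gen 28 (unit `lit-balaban-r08`; item (c) of `HOME/lit-balaban-r08/B11-CLOSURE.md` §5).  SKELETON rows **B11.Prop4** (decl of record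
`B11.Prop4Printed`, head `typed-existing`, ASSEMBLED `B11Prop4Assembly.prop4Printed_of_termwise`) and **B11.Prop6** (`B11.Prop6Printed`,
`B11Prop6Model.prop6Printed_model`).  THE PRINT (p. 292–293, verbatim): *«Proposition 4. Let us consider the functional V(A′) on the space of
configurations A′ with values in the complexified Lie algebra 𝔤ᶜ, and satisfying the inequalities (77), i.e. max{|A′|₍₋₁₎, |∇A′|₍₋₂₎} < ε₃, for
ε₃ ≦ a₃, where a₃ is a sufficiently small positive constant. The functional derivative of V(A′) is an analytic function on this space, and
satisfies the estimate |((δ/δA′)V)(A′)| < C₄ε₃²(Lʲη)⁻³ on Ω_j, j = 0, 1, …, k. (97) The constants a₃, C₄ depend on d and L only.»*; p. 295: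
*«Proposition 6. There exists a positive, absolute constant a₄ such, that for ε₄ ≦ a₄ and ε₁ satisfying 2B₀C₁B₃ε₁ ≦ ε₄ Eq. (111) has exactly
one solution in the space (115). …»*.

WHAT THIS FILE PROVES (kernel-checked, 0 sorry, standard axioms).  For ONE lattice (the NE9 carriers `Space115 L η lev₀ lev₁ Dc` ∋ A′ with
the norm of (115), `NegSize L η lev₀ 3 𝔸` ∋ currents with `|·|₍₋₃₎`), ONE background `U₀` and the NE9 object
`W80 ρ τ U₀ H C ε_C J Δπ = (δ/δA′)V` (`B11Eq80Current.W80`, (63)-certified by `pair27_W80`):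
* §1 `prop4Hyp_mono` — `Prop4Hyp W C₄ a₃` is monotone in `C₄`; `schemeDatumW80` (def with body) — the Sect. D–E scheme datum of
  `B11Prop6Model.SchemeDatum` whose W-slot IS `W80 …` and whose `prop4` field is NE9's `B11Eq98CurrentSlot.prop4Hyp_W80` (constant `C4W … + 1`,
  radius `R′`), with the propagator slot a letter `𝒢` under «Theorem 3.13 of [5]» `‖𝒢f‖ ≤ B₀′‖f‖`, the current slot a letter `J` and the datum
  `H₁B` a letter `𝔄` — index set `PUnit` (one instance).
* §2 **`prop4Printed_W80 : B11.Prop4Printed C₁ B₃ (fun _ : PUnit => (schemeDatumW80 …).toLGData C₁)`** and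
  **`prop6Printed_W80 : B11.Prop6Printed B₀′ B₃ C₁ (same family)`** — the typed statements of record inhabited BY NAME at the concrete `W`
  (`B11Prop6Model.prop4Printed_model` / `prop6Printed_model`), under EXACTLY the displayed hypotheses of `prop4Hyp_W80`: the Sect. C regime
  `Regime H 0 C b 0 C₂ c₄ 0 a_C ε_C` and `Prop4Hyp C C₂ c₄` of (47), the V₀-group slot `‖curV0 Y‖ ≤ C_V‖Y‖²` on `‖Y‖ < R_V`, the kernel-column
  letters θ_E, θ₃ (`hΘE`, `hΘ3`), the radius `0 < R′ ≤ a_C`, `R′ ≤ (1 − 4bC₂(ε_C + a_C))R_V`, plus `‖𝒢f‖ ≤ B₀′‖f‖` and `dL ≤ B₃`.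

HONEST SCOPE — what is NOT claimed.  (i) MODEL INSTANCE, ONE LATTICE: the index set is `PUnit`; every NEEDS-CONSTANT letter of NE9's
`prop4Hyp_W80` (θ_E, θ₃, ‖J‖, ‖Δπ‖, C_V, R′) is displayed, so print's «a₃, C₄ depend on d and L only» is NOT adjudicated (cf.
`B11Ineq73KernelLettersUniform.exists_quadAnalytic_W80_uniform` for the data-uniform-at-a-fixed-lattice form); `C₄` of the typed statement is
`C4W … + 1` (the `+ 1` only to make it positive as `Prop4Printed` requires), `a₃` is `R′` (served with `R′/2` by `prop4Printed_model`).
(ii) `𝒢`, `J`, `𝔄` are letters (their NE9 instances `frakG`, `Jcur U₀`, `H₁B` exist — `B11Eq111FrakG`, `B11Eq98CurrentSlot.Jcur`,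
`B11Eq103H1Complex` — and may be substituted by the consumer; nothing of [5] is constructed here).  (iii) `Cfg = Bdry = PUnit`: the background and
the boundary datum are fixed, so the `Sat14` hypothesis of the typed statements reads `‖J‖ ≤ C₁B₃ε₁ ∧ ‖𝔄‖ < 2dLB₀′C₁ε₁` on the letters.
(iv) NON-VACUITY is NE9's, by name: the displayed letters are inhabited per lattice by `B11Eq44COperatorTorus.regime_sectC` / `prop4Hyp_Cc` (the Sect. C regime of the concrete `Cc`), `B11Eq63V0GroupCurrent.quadAnalytic_curV0` (the V₀-slot) and `B11Eq98WSlotSectCPerLattice.exists_WSlot_sectC_of_contractive` (the whole W-slot with θ_E, θ₃, R′ produced per lattice) — not re-assembled here.  (v) No row head moves (B11.Prop4 / B11.Prop6 stay `typed-existing` + ASSEMBLED/INHABITED; this adds «inhabited at NE9's W80, one lattice»).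
Imports `B11Eq98CurrentSlot` (NE9 leaf-05) and `B11Prop6Model` (r08 g6); modifies nothing; one def with body, no `Prop`-valued definition, no
new named fact (net debt delta 0).
-/

noncomputable section

open NormedSpace Metric Set

namespace Literature.MathematicalPhysics.QuantumFieldTheory.Balaban1983to89.B11Prop4ModelW80

open Literature.MathematicalPhysics.QuantumFieldTheory.Balaban1983to89.B11Prop6Scheme (Prop4Hyp)
open Literature.MathematicalPhysics.QuantumFieldTheory.Balaban1983to89.B11Prop6Model (SchemeDatum prop4Printed_model prop6Printed_model)
open Literature.MathematicalPhysics.QuantumFieldTheory.Balaban1983to89.B11Eq174Chart (Regime)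
open Literature.MathematicalPhysics.QuantumFieldTheory.Balaban1983to89.B11Eq63V0GroupCurrent (curV0)
open Literature.MathematicalPhysics.QuantumFieldTheory.Balaban1983to89.B11Eq90Transpose (kernel)
open Literature.MathematicalPhysics.QuantumFieldTheory.Balaban1983to89.B11Eq80Current (Emap E3 W80)
open Literature.MathematicalPhysics.QuantumFieldTheory.Balaban1983to89.B11Eq98CurrentSlot (C4W C4W_nonneg prop4Hyp_W80)
open Literature.MathematicalPhysics.QuantumFieldTheory.Balaban1983to89.B9SectCLatticeCarrier (Bond)
open Literature.MathematicalPhysics.QuantumFieldTheory.Balaban1983to89.B11Eq115Space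

/-! ## §1 Monotonicity of `Prop4Hyp` in the constant; the scheme datum at `W80` -/

section Mono

variable {𝒴 𝒵 : Type*} [NormedAddCommGroup 𝒴] [NormedSpace ℂ 𝒴] [NormedAddCommGroup 𝒵] [NormedSpace ℂ 𝒵]

/-- `Prop4Hyp W C₄ a₃` is monotone in the constant `C₄` ((98) with a larger constant). [cite: Balaban1985Variational, Prop. 4 (98) p.293] -/
theorem prop4Hyp_mono {W : 𝒴 → 𝒵} {C₄ C₄' a₃ : ℝ} (h : Prop4Hyp W C₄ a₃) (hle : C₄ ≤ C₄') : Prop4Hyp W C₄' a₃ where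
  quad Y hY := (h.quad Y hY).trans (mul_le_mul_of_nonneg_right hle (sq_nonneg _))
  differentiableOn := h.differentiableOn

end Mono

variable {𝔸 : Type} [NormedRing 𝔸] [NormedAlgebra ℂ 𝔸] [FiniteDimensional ℂ 𝔸] [CompleteSpace 𝔸]
variable {d : ℕ} {Pd : Fin d → ℕ} {L η : ℝ} [Fact (0 < L)] [Fact (0 < η)] {lev₀ : Bond d Pd → ℕ} {κ' : Type} [Fintype κ']
  {lev₁ : κ' → ℕ} {Dc : (Bond d Pd → 𝔸) →ₗ[ℂ] (κ' → 𝔸)}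
variable {𝒳 : Type} [NormedAddCommGroup 𝒳] [NormedSpace ℂ 𝒳] [CompleteSpace 𝒳]
variable {H : 𝒳 →L[ℂ] Space115 L η lev₀ lev₁ Dc} {C : Space115 L η lev₀ lev₁ Dc → 𝒳} {b C₂ c₄ aC εC : ℝ}
variable (ρ : (𝔸 →L[ℂ] ℂ) →L[ℂ] 𝔸) (τ : 𝔸 →L[ℂ] ℂ)

/-- **The Sect. D–E scheme datum AT `W80`** (one lattice, one background): W-slot `W80 ρ τ U₀ H C ε_C J Δπ` with a `Prop4Hyp` supplied by
the caller (in §2: NE9's `prop4Hyp_W80`, constant raised by `1`), propagator letter `𝒢` with «Theorem 3.13 of [5]» `‖𝒢f‖ ≤ B₀′‖f‖` ((117)),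
current letter `J` ((27)–(28)), datum letter `𝔄` (= H₁B, (103)); `Cfg = Bdry = PUnit`.
[cite: Balaban1985Variational, (111), (115) p.294, (116)–(117) p.295, Prop. 4 (97)–(98) pp.292–293] -/
def schemeDatumW80 (U₀ : Bond d Pd → 𝔸ˣ) (J : NegSize L η lev₀ 3 𝔸)
    (Δπ : Space115 L η lev₀ lev₁ Dc →L[ℂ] NegSize L η lev₀ 3 𝔸)
    (𝒢 : NegSize L η lev₀ 3 𝔸 →L[ℂ] Space115 L η lev₀ lev₁ Dc) (𝔄 : Space115 L η lev₀ lev₁ Dc) {B₀' C₄ R' B₃ : ℝ}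
    (hG : ∀ f, ‖𝒢 f‖ ≤ B₀' * ‖f‖) (hW : Prop4Hyp (W80 ρ τ U₀ H C εC J Δπ) C₄ R') (hdL : (d : ℝ) * L ≤ B₃) :
    SchemeDatum (Space115 L η lev₀ lev₁ Dc) (NegSize L η lev₀ 3 𝔸) PUnit PUnit B₀' C₄ R' B₃ where
  L := L
  dim := d
  G := 𝒢
  W := W80 ρ τ U₀ H C εC J Δπ
  J := fun _ => J
  H₁B := fun _ _ => 𝔄
  norm_G := hG
  prop4 := hW
  L_nonneg := le_of_lt (Fact.out : 0 < L)
  dL_le := hdL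

omit [CompleteSpace 𝔸] [CompleteSpace 𝒳] in
/-- Unfolding: the W-slot of the datum IS `W80`. [cite: Balaban1985Variational, (80) p.290] -/
@[simp] theorem schemeDatumW80_W (U₀ : Bond d Pd → 𝔸ˣ) (J : NegSize L η lev₀ 3 𝔸)
    (Δπ : Space115 L η lev₀ lev₁ Dc →L[ℂ] NegSize L η lev₀ 3 𝔸)
    (𝒢 : NegSize L η lev₀ 3 𝔸 →L[ℂ] Space115 L η lev₀ lev₁ Dc) (𝔄 : Space115 L η lev₀ lev₁ Dc) {B₀' C₄ R' B₃ : ℝ}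
    (hG : ∀ f, ‖𝒢 f‖ ≤ B₀' * ‖f‖) (hW : Prop4Hyp (W80 ρ τ U₀ H C εC J Δπ) C₄ R') (hdL : (d : ℝ) * L ≤ B₃) :
    (schemeDatumW80 ρ τ U₀ J Δπ 𝒢 𝔄 hG hW hdL).W = W80 ρ τ U₀ H C εC J Δπ := rfl

/-! ## §2 Propositions 4 and 6 — the typed statements of record INHABITED at `W80` (one lattice) -/

/-- **`B11.Prop4Printed` AT NE9's CONCRETE `W = (δ/δA′)V = W80`** (model instance, one lattice, one background): under exactly the displayed
hypotheses of `B11Eq98CurrentSlot.prop4Hyp_W80` (Sect. C regime and `Prop4Hyp` of the letter `C`, the V₀-group slot, the kernel-column letters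
θ_E, θ₃, the radius `0 < R′ ≤ a_C`, `R′ ≤ (1 − 4bC₂(ε_C + a_C))R_V`) plus the propagator letter `‖𝒢f‖ ≤ B₀′‖f‖` and `dL ≤ B₃`, the typed
Proposition 4 holds for the one-member family built on `schemeDatumW80` — with `C₄ = C4W(…) + 1`, `a₃ = R′` (served at `R′/2`).
[cite: Balaban1985Variational, Prop. 4 (97)–(98) pp.292–293] -/
theorem prop4Printed_W80 (U₀ : Bond d Pd → 𝔸ˣ) {CV RV : ℝ} (hCV : 0 ≤ CV)
    (hqV : ∀ Y : Space115 L η lev₀ lev₁ Dc, ‖Y‖ < RV → ‖curV0 (lev₁ := lev₁) (Dc := Dc) ρ τ U₀ Y‖ ≤ CV * ‖Y‖ ^ 2)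
    (RC : Regime H 0 C b 0 C₂ c₄ 0 aC εC) (hC : Prop4Hyp C C₂ c₄) (J : NegSize L η lev₀ 3 𝔸)
    (Δπ : Space115 L η lev₀ lev₁ Dc →L[ℂ] NegSize L η lev₀ 3 𝔸) {R' θ₃ θE : ℝ} (hθ₃ : 0 ≤ θ₃) (hθE : 0 ≤ θE) (hR'0 : 0 < R')
    (hR'a : R' ≤ aC) (hR'V : R' ≤ (1 - 4 * b * C₂ * (εC + aC)) * RV)
    (hΘE : ∀ A' : Space115 L η lev₀ lev₁ Dc, ‖A'‖ < R' → ∀ bb : Bond d Pd, ∑ b' : Bond d Pd,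
      levWeight L η lev₀ 3 bb / levWeight L η lev₀ 3 b' * ‖kernel (fderiv ℂ (Emap H C εC) A') b' bb‖ ≤ θE * ‖A'‖)
    (hΘ3 : ∀ A' : Space115 L η lev₀ lev₁ Dc, ‖A'‖ < R' → ∀ bb : Bond d Pd, ∑ b' : Bond d Pd,
      levWeight L η lev₀ 3 bb / levWeight L η lev₀ 3 b' * ‖kernel (fderiv ℂ (E3 H C εC) A') b' bb‖ ≤ θ₃ * ‖A'‖ ^ 2)
    (𝒢 : NegSize L η lev₀ 3 𝔸 →L[ℂ] Space115 L η lev₀ lev₁ Dc) (𝔄 : Space115 L η lev₀ lev₁ Dc) {B₀' B₃ C₁ : ℝ}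
    (hG : ∀ f, ‖𝒢 f‖ ≤ B₀' * ‖f‖) (hdL : (d : ℝ) * L ≤ B₃) :
    B11.Prop4Printed C₁ B₃ (fun _ : PUnit =>
      (schemeDatumW80 ρ τ U₀ J Δπ 𝒢 𝔄 hG
        (prop4Hyp_mono (prop4Hyp_W80 ρ τ U₀ hCV hqV RC hC J Δπ hθ₃ hθE hR'0.le hR'a hR'V hΘE hΘ3) (le_add_of_nonneg_right zero_le_one))
        hdL).toLGData C₁) :=
  prop4Printed_model (fun _ => Space115 L η lev₀ lev₁ Dc) (fun _ => NegSize L η lev₀ 3 𝔸) (fun _ => PUnit) (fun _ => PUnit)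
    (add_pos_of_nonneg_of_pos (C4W_nonneg (norm_nonneg ρ) (norm_nonneg τ) (norm_nonneg J) (norm_nonneg Δπ) RC.B₀_nonneg
      RC.C₄_nonneg hθ₃ hθE hCV hR'0.le) one_pos) hR'0 _

/-- **`B11.Prop6Printed` ON THE SAME ONE-MEMBER FAMILY** (`B11Prop6Model.prop6Printed_model`): Proposition 6's existence / uniqueness /
analyticity-in-𝔄 clauses for Eq. (111) with `W = W80` and the letters `𝒢`, `J`, `𝔄`, for `0 < B₀′`, `0 < B₃`, `0 < C₁`.
[cite: Balaban1985Variational, Prop. 6 pp.295–296] -/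
theorem prop6Printed_W80 (U₀ : Bond d Pd → 𝔸ˣ) {CV RV : ℝ} (hCV : 0 ≤ CV)
    (hqV : ∀ Y : Space115 L η lev₀ lev₁ Dc, ‖Y‖ < RV → ‖curV0 (lev₁ := lev₁) (Dc := Dc) ρ τ U₀ Y‖ ≤ CV * ‖Y‖ ^ 2)
    (RC : Regime H 0 C b 0 C₂ c₄ 0 aC εC) (hC : Prop4Hyp C C₂ c₄) (J : NegSize L η lev₀ 3 𝔸)
    (Δπ : Space115 L η lev₀ lev₁ Dc →L[ℂ] NegSize L η lev₀ 3 𝔸) {R' θ₃ θE : ℝ} (hθ₃ : 0 ≤ θ₃) (hθE : 0 ≤ θE) (hR'0 : 0 < R')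
    (hR'a : R' ≤ aC) (hR'V : R' ≤ (1 - 4 * b * C₂ * (εC + aC)) * RV)
    (hΘE : ∀ A' : Space115 L η lev₀ lev₁ Dc, ‖A'‖ < R' → ∀ bb : Bond d Pd, ∑ b' : Bond d Pd,
      levWeight L η lev₀ 3 bb / levWeight L η lev₀ 3 b' * ‖kernel (fderiv ℂ (Emap H C εC) A') b' bb‖ ≤ θE * ‖A'‖)
    (hΘ3 : ∀ A' : Space115 L η lev₀ lev₁ Dc, ‖A'‖ < R' → ∀ bb : Bond d Pd, ∑ b' : Bond d Pd,
      levWeight L η lev₀ 3 bb / levWeight L η lev₀ 3 b' * ‖kernel (fderiv ℂ (E3 H C εC) A') b' bb‖ ≤ θ₃ * ‖A'‖ ^ 2)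
    (𝒢 : NegSize L η lev₀ 3 𝔸 →L[ℂ] Space115 L η lev₀ lev₁ Dc) (𝔄 : Space115 L η lev₀ lev₁ Dc) {B₀' B₃ C₁ : ℝ}
    (hB₀ : 0 < B₀') (hB₃ : 0 < B₃) (hC₁ : 0 < C₁)
    (hG : ∀ f, ‖𝒢 f‖ ≤ B₀' * ‖f‖) (hdL : (d : ℝ) * L ≤ B₃) :
    B11.Prop6Printed B₀' B₃ C₁ (fun _ : PUnit =>
      (schemeDatumW80 ρ τ U₀ J Δπ 𝒢 𝔄 hG
        (prop4Hyp_mono (prop4Hyp_W80 ρ τ U₀ hCV hqV RC hC J Δπ hθ₃ hθE hR'0.le hR'a hR'V hΘE hΘ3) (le_add_of_nonneg_right zero_le_one))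
        hdL).toLGData C₁) :=
  prop6Printed_model (fun _ => Space115 L η lev₀ lev₁ Dc) (fun _ => NegSize L η lev₀ 3 𝔸) (fun _ => PUnit) (fun _ => PUnit) hB₀
    (add_pos_of_nonneg_of_pos (C4W_nonneg (norm_nonneg ρ) (norm_nonneg τ) (norm_nonneg J) (norm_nonneg Δπ) RC.B₀_nonneg
      RC.C₄_nonneg hθ₃ hθE hCV hR'0.le) one_pos) hR'0 hB₃ hC₁ _

end Literature.MathematicalPhysics.QuantumFieldTheory.Balaban1983to89.B11Prop4ModelW80

end
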